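import Mathlib.Analysis.Calculus.FDeriv.Symmetric
import Mathlib.Analysis.Calculus.ContDiff.Comp
import Mathlib.Analysis.Complex.Basic

/-!
# The linearised Cauchy–Riemann equation along a flat `J`-holomorphic family
(registered helper `helper_linearisedCRFamily` of line `cross-cap-laurent`, crux
`GromovRecognitionRelEnd`, item stmt-SmoothPoincare4-11009; it serves the child stub
`stub_normalVelocityDichotomy` of the local-foliation fact, item stmt-SmoothPoincare4-16778)

Setting (flat, i.e. in a chart; Wendl 2018, Prop. 2.53 / McDuff–Salamon 2012, §3.1): `F` a real
normed space, `J : F → (F →L[ℝ] F)` a field of endomorphisms that is `C^∞` on an open set `T`, and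
a family `Φ : ℂ × ℂ → F`, `(a, z) ↦ Φ (a, z)`, `C^∞` on an open set `S` and mapping `S` into `T`,
such that every slice `z ↦ Φ (a, z)` is `J`-holomorphic in the sense
`D_z Φ (a, ·) (I ζ) = J (Φ (a, z)) (D_z Φ (a, ·) ζ)` at all points of `S`
(the Cauchy–Riemann equation `∂_y u = J(u) ∂ₓ u` written with Fréchet derivatives).

Claim (`helper_linearisedCRFamily`): the `a`-derivative `ξ (a, z) := D_a Φ (·, z) c` of the family
satisfies the *linearised* Cauchy–Riemann equation
`D_z ξ (I ζ) = J (Φ) (D_z ξ ζ) + (D J (Φ) [ξ]) (D_z Φ (a, ·) ζ)` at every point of `S`.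

Proof (pure calculus).  Fix `p = (a₀, z₀) ∈ S`.  As `S` is open, `Φ` is `ContDiffAt ℝ ∞` at the
points of `S`, so the full derivative `D := fderiv ℝ Φ` exists there, `D` is differentiable at `p`,
and the second derivative `fderiv ℝ D p` is symmetric (`ContDiffAt.isSymmSndFDerivAt`).  The partial
derivatives are read off the full one by the chain rule through `a ↦ (a, z)` and `z ↦ (a, z)`:
`fderiv ℝ (fun a => Φ (a, z)) a c = D (a, z) (c, 0)` and
`fderiv ℝ (fun z => Φ (a, z)) z ζ = D (a, z) (0, ζ)` on `S`.  Hence near `z₀` the function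
`z ↦ fderiv ℝ (fun a => Φ (a, z)) a₀ c` agrees with `z ↦ D (a₀, z) (c, 0)`, whose derivative at
`z₀` in the direction `w` is `fderiv ℝ D p (0, w) (c, 0) = fderiv ℝ D p (c, 0) (0, w)` (symmetry).
On the other hand the two sides of the Cauchy–Riemann identity, `a ↦ D (a, z₀) (0, I ζ)` and
`a ↦ J (Φ (a, z₀)) (D (a, z₀) (0, ζ))`, agree for `a` near `a₀`, so their derivatives at `a₀`
coincide (uniqueness of the Fréchet derivative); the first is `c ↦ fderiv ℝ D p (c, 0) (0, I ζ)`,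
the second is computed by the Leibniz rule for `a ↦ (L a) (v a)` (`HasFDerivAt.clm_apply`) and
the chain rule for `L = J ∘ Φ (·, z₀)` (`J` is differentiable at `Φ p ∈ T`, `T` open):
`c ↦ J (Φ p) (fderiv ℝ D p (c, 0) (0, ζ)) + (fderiv ℝ J (Φ p) (D p (c, 0))) (D p (0, ζ))`.
Substituting gives the claim.

References: D. McDuff, D. Salamon, *J-holomorphic Curves and Symplectic Topology* (2nd ed., 2012),
§3.1 (the linearised operator `D_u`); C. Wendl, *Holomorphic Curves in Low Dimensions* (2018),
Prop. 2.53 (context).  No new definitions, notation or instances; Mathlib only.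
-/

open scoped ContDiff Topology
open Set Function Filter

-- the prescribed namespace `Summit.<P>.<Sub>.…` duplicates `SmoothPoincare4` (P = Sub)
set_option linter.dupNamespace false

namespace Summit.SmoothPoincare4.SmoothPoincare4.Theorems.GromovRecognitionRelEnd.CrossCapLaurent

namespace LinearisedCRFamily

variable {𝕜 : Type*} [NontriviallyNormedField 𝕜]
  {E₁ E₂ G H : Type*} [NormedAddCommGroup E₁] [NormedSpace 𝕜 E₁]
  [NormedAddCommGroup E₂] [NormedSpace 𝕜 E₂] [NormedAddCommGroup G] [NormedSpace 𝕜 G]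
  [NormedAddCommGroup H] [NormedSpace 𝕜 H]

/-- **Partial derivative in the first variable from the full derivative.**  If `Φ : E₁ × E₂ → G`
has Fréchet derivative `L` at `(a, z)`, then the slice `b ↦ Φ (b, z)` has derivative `L ∘ inl` at
`a` (chain rule through `b ↦ (b, z)`). [folklore] -/
theorem hasFDerivAt_sliceLeft {Φ : E₁ × E₂ → G} {a : E₁} {z : E₂} {L : E₁ × E₂ →L[𝕜] G}
    (h : HasFDerivAt Φ L (a, z)) :
    HasFDerivAt (fun b : E₁ => Φ (b, z)) (L.comp (ContinuousLinearMap.inl 𝕜 E₁ E₂)) a :=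
  h.comp a (hasFDerivAt_prodMk_left a z)

/-- **Partial derivative in the second variable from the full derivative.**  If `Φ : E₁ × E₂ → G`
has Fréchet derivative `L` at `(a, z)`, then the slice `w ↦ Φ (a, w)` has derivative `L ∘ inr` at
`z` (chain rule through `w ↦ (a, w)`). [folklore] -/
theorem hasFDerivAt_sliceRight {Φ : E₁ × E₂ → G} {a : E₁} {z : E₂} {L : E₁ × E₂ →L[𝕜] G}
    (h : HasFDerivAt Φ L (a, z)) :
    HasFDerivAt (fun w : E₂ => Φ (a, w)) (L.comp (ContinuousLinearMap.inr 𝕜 E₁ E₂)) z :=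
  h.comp z (hasFDerivAt_prodMk_right a z)

/-- **Partial derivative in the first variable, evaluated.**  If `Φ : E₁ × E₂ → G` has Fréchet
derivative `L` at `(a, z)`, then `fderiv 𝕜 (fun b => Φ (b, z)) a c = L (c, 0)`. [folklore] -/
theorem fderiv_sliceLeft_apply {Φ : E₁ × E₂ → G} {a : E₁} {z : E₂} {L : E₁ × E₂ →L[𝕜] G}
    (h : HasFDerivAt Φ L (a, z)) (c : E₁) :
    fderiv 𝕜 (fun b : E₁ => Φ (b, z)) a c = L (c, 0) := by
  rw [(hasFDerivAt_sliceLeft h).fderiv]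
  simp

/-- **Partial derivative in the second variable, evaluated.**  If `Φ : E₁ × E₂ → G` has Fréchet
derivative `L` at `(a, z)`, then `fderiv 𝕜 (fun v => Φ (a, v)) z w = L (0, w)`. [folklore] -/
theorem fderiv_sliceRight_apply {Φ : E₁ × E₂ → G} {a : E₁} {z : E₂} {L : E₁ × E₂ →L[𝕜] G}
    (h : HasFDerivAt Φ L (a, z)) (w : E₂) :
    fderiv 𝕜 (fun v : E₂ => Φ (a, v)) z w = L (0, w) := by
  rw [(hasFDerivAt_sliceRight h).fderiv]
  simp

/-- **Derivative of the evaluation at a fixed vector.**  If the operator-valued map `c` has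
Fréchet derivative `c'` at `x`, then `y ↦ c y v` has derivative `(ev_v) ∘ c'` at `x`, where
`ev_v = ContinuousLinearMap.apply 𝕜 H v` is evaluation at `v`. [folklore] -/
theorem hasFDerivAt_clm_apply_const {c : E₁ → G →L[𝕜] H} {c' : E₁ →L[𝕜] G →L[𝕜] H} {x : E₁}
    (hc : HasFDerivAt c c' x) (v : G) :
    HasFDerivAt (fun y => c y v) ((ContinuousLinearMap.apply 𝕜 H v).comp c') x :=
  (ContinuousLinearMap.apply 𝕜 H v).hasFDerivAt.comp x hc

end LinearisedCRFamily

open LinearisedCRFamily in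
/-- **The linearisation of a flat `J`-holomorphic family satisfies the linearised Cauchy–Riemann
equation** (McDuff–Salamon 2012, §3.1; Wendl 2018, Prop. 2.53).  Let `J : F → (F →L[ℝ] F)` be
`C^∞` on an open `T`, and `Φ : ℂ × ℂ → F` be `C^∞` on an open `S`, with `Φ '' S ⊆ T`, such that
`fderiv ℝ (fun z => Φ (a, z)) z (I ζ) = J (Φ (a, z)) (fderiv ℝ (fun z => Φ (a, z)) z ζ)` at every
`(a, z) ∈ S`.  Then for `p = (a₀, z₀) ∈ S` and `c ζ : ℂ`, the `a`-derivative
`ξ z := fderiv ℝ (fun a => Φ (a, z)) a₀ c` satisfies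
`fderiv ℝ ξ z₀ (I ζ) = J (Φ p) (fderiv ℝ ξ z₀ ζ) + (fderiv ℝ J (Φ p) (ξ z₀)) (∂ζ u)` with
`∂ζ u := fderiv ℝ (fun z => Φ (a₀, z)) z₀ ζ`, i.e. `∂̄ ξ` is the derivative of `J` along `ξ`
applied to `∂ u` (differentiate the Cauchy–Riemann identity in `a` and exchange the order of
differentiation by the symmetry of the second derivative). [cite: McDuffSalamon2012, Section 3.1] -/
theorem helper_linearisedCRFamily : ∀ (F : Type) [NormedAddCommGroup F] [NormedSpace ℝ F] (J : F → F →L[ℝ] F) (T : Set F) (Φ : ℂ × ℂ → F) (S : Set (ℂ × ℂ)), IsOpen T → IsOpen S → ContDiffOn ℝ ∞ J T → ContDiffOn ℝ ∞ Φ S → Set.MapsTo Φ S T → (∀ p ∈ S, ∀ ζ : ℂ, fderiv ℝ (fun z : ℂ => Φ (p.1, z)) p.2 (Complex.I * ζ) = J (Φ p) (fderiv ℝ (fun z : ℂ => Φ (p.1, z)) p.2 ζ)) → ∀ p ∈ S, ∀ c ζ : ℂ, fderiv ℝ (fun z : ℂ => fderiv ℝ (fun a : ℂ => Φ (a, z))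 p.1 c) p.2 (Complex.I * ζ) = J (Φ p) (fderiv ℝ (fun z : ℂ => fderiv ℝ (fun a : ℂ => Φ (a, z)) p.1 c) p.2 ζ) + (fderiv ℝ J (Φ p) (fderiv ℝ (fun a : ℂ => Φ (a, p.2)) p.1 c)) (fderiv ℝ (fun z : ℂ => Φ (p.1, z)) p.2 ζ) := by
  intro F _ _ J T Φ S hT hS hJ hΦ hΦT hCR p hp c ζ
  obtain ⟨a₀, z₀⟩ := p
  dsimp only
  -- `Φ` is `C^∞` at the points of the open set `S`; its full derivative `D` there
  have hΦat : ∀ q ∈ S, ContDiffAt ℝ ∞ Φ q := fun q hq => hΦ.contDiffAt (hS.mem_nhds hq)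
  have hD : ∀ q ∈ S, HasFDerivAt Φ (fderiv ℝ Φ q) q := fun q hq =>
    ((hΦat q hq).differentiableAt (by simp)).hasFDerivAt
  set D := fderiv ℝ Φ
  -- the (symmetric) second derivative at `p`
  have hD2 : HasFDerivAt D (fderiv ℝ D (a₀, z₀)) (a₀, z₀) :=
    (((hΦat _ hp).fderiv_right (m := ∞) le_rfl).differentiableAt (by simp)).hasFDerivAt
  have hsymm : IsSymmSndFDerivAt ℝ Φ (a₀, z₀) :=
    (hΦat _ hp).isSymmSndFDerivAt (by simpa using (WithTop.coe_le_coe.2 le_top : (2 : ℕ∞ω) ≤ ∞))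
  -- the points `(a₀, z)` and `(a, z₀)` stay in `S` for `z` near `z₀` and `a` near `a₀`
  have hz : ∀ᶠ z in 𝓝 z₀, (a₀, z) ∈ S :=
    (Continuous.prodMk_right a₀).continuousAt.preimage_mem_nhds (hS.mem_nhds hp)
  have ha : ∀ᶠ a in 𝓝 a₀, (a, z₀) ∈ S :=
    (Continuous.prodMk_left z₀).continuousAt.preimage_mem_nhds (hS.mem_nhds hp)
  -- Step 1: the `z`-derivative of `ξ = ∂_a Φ · c` is the (symmetric) mixed second derivative
  have hξeq : (fun z : ℂ => fderiv ℝ (fun a : ℂ => Φ (a, z)) a₀ c) =ᶠ[𝓝 z₀]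
      fun z : ℂ => D (a₀, z) (c, 0) := by
    filter_upwards [hz] with z hzS
    exact fderiv_sliceLeft_apply (hD _ hzS) c
  have hξ : HasFDerivAt (fun z : ℂ => fderiv ℝ (fun a : ℂ => Φ (a, z)) a₀ c)
      ((ContinuousLinearMap.apply ℝ F ((c, 0) : ℂ × ℂ)).comp
        ((fderiv ℝ D (a₀, z₀)).comp (ContinuousLinearMap.inr ℝ ℂ ℂ))) z₀ :=
    (hasFDerivAt_clm_apply_const (hasFDerivAt_sliceRight hD2) (c, 0)).congr_of_eventuallyEq hξeq
  have hξ' : ∀ w : ℂ, fderiv ℝ (fun z : ℂ => fderiv ℝ (fun a : ℂ => Φ (a, z)) a₀ c) z₀ w =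
      fderiv ℝ D (a₀, z₀) (c, 0) (0, w) := by
    intro w
    rw [hξ.fderiv]
    simpa using hsymm (0, w) (c, 0)
  -- Step 2: differentiate the Cauchy–Riemann identity in the `a`-direction at `a₀`
  have hJat : DifferentiableAt ℝ J (Φ (a₀, z₀)) :=
    (hJ.contDiffAt (hT.mem_nhds (hΦT hp))).differentiableAt (by simp)
  have hJΦ : HasFDerivAt (fun a : ℂ => J (Φ (a, z₀)))
      ((fderiv ℝ J (Φ (a₀, z₀))).comp ((D (a₀, z₀)).comp (ContinuousLinearMap.inl ℝ ℂ ℂ))) a₀ :=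
    hJat.hasFDerivAt.comp a₀ (hasFDerivAt_sliceLeft (hD _ hp))
  have h1 : HasFDerivAt (fun a : ℂ => D (a, z₀) (0, Complex.I * ζ))
      ((ContinuousLinearMap.apply ℝ F ((0, Complex.I * ζ) : ℂ × ℂ)).comp
        ((fderiv ℝ D (a₀, z₀)).comp (ContinuousLinearMap.inl ℝ ℂ ℂ))) a₀ :=
    hasFDerivAt_clm_apply_const (hasFDerivAt_sliceLeft hD2) (0, Complex.I * ζ)
  have h2 : HasFDerivAt (fun a : ℂ => D (a, z₀) (0, ζ))
      ((ContinuousLinearMap.apply ℝ F ((0, ζ) : ℂ × ℂ)).comp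
        ((fderiv ℝ D (a₀, z₀)).comp (ContinuousLinearMap.inl ℝ ℂ ℂ))) a₀ :=
    hasFDerivAt_clm_apply_const (hasFDerivAt_sliceLeft hD2) (0, ζ)
  have h3 := hJΦ.clm_apply h2
  -- the two sides of the Cauchy–Riemann identity, read through `D`, agree for `a` near `a₀`
  have hCReq : (fun a : ℂ => D (a, z₀) (0, Complex.I * ζ)) =ᶠ[𝓝 a₀]
      fun a : ℂ => J (Φ (a, z₀)) (D (a, z₀) (0, ζ)) := by
    filter_upwards [ha] with a haS
    have := hCR (a, z₀) haS ζ
    dsimp only at this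
    rwa [fderiv_sliceRight_apply (hD _ haS), fderiv_sliceRight_apply (hD _ haS)] at this
  -- hence their derivatives at `a₀` coincide; evaluate at `c`
  have h4 := congrArg (fun L : ℂ →L[ℝ] F => L c) (h1.unique (h3.congr_of_eventuallyEq hCReq))
  simp only [ContinuousLinearMap.comp_apply, add_apply, ContinuousLinearMap.inl_apply,
    ContinuousLinearMap.apply_apply, ContinuousLinearMap.flip_apply] at h4
  -- Step 3: assemble
  rw [hξ', hξ', fderiv_sliceLeft_apply (hD _ hp), fderiv_sliceRight_apply (hD _ hp), h4]

end Summit.SmoothPoincare4.SmoothPoincare4.Theorems.GromovRecognitionRelEnd.CrossCapLaurent
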